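import Literature.NumberTheory.LFunctions.KloostermanFractionsAmplifier
import HarnessLib

/-!
# Trilinear forms with Kloosterman fractions: the amplified second moment (§2) and (5.1)-bookkeeping

Topic `NumberTheory/LFunctions`.  S. Bettin, V. Chandee, *Trilinear forms with Kloosterman
fractions*, Adv. Math. 328 (2018), §2: after Cauchy–Schwarz and the amplifier,
"`𝓒_b ≪ M L^{-2+ε} 𝓓_b`" (2.2) and "squaring out and exploiting the orthogonality relation of
character sums, we obtain `𝓓_b = … = 𝒟_b + 𝒪_b`" (2.4).  For the general-`A`, twisted moments of
the reduction of the named fact `BettinChandee2018_trilinearKloostermanFractions` (whose (5.1)-type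
bound is the hypothesis of `BC_CbA_bound_of_LA_bound`, `TrilinearKloostermanFractionsOptimiseL.lean`)
the coefficient of the inner sum is `c_m(n') = γ_{n'} ∑_a ν_a e(ϑ a m̄^{(bn')}/(bn') + η a/(m bn'))`,
which depends on `m`; this file PROVES the amplification step for ARBITRARY `m`-dependent
coefficients (the tree's `kfCS_le_diag_add_off`, `KloostermanFractionsAmplifiedFormIoc.lean`, is the
case `c_m(n) = γ_n e(k m̄/(bn))`), together with the real-variable bookkeeping of §5 for the six
terms of (5.1) with their `A`-powers:

* `BC_ampSigma_re_nonneg` — `Σ_m(c) = ∑_{ℓ₁,n₁,ℓ₂,n₂ : (ℓ₂n₂,m)=1, ℓ₁n₁≡ℓ₂n₂ (m)} c_m(n₁) conj c_m(n₂)`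
  is a nonnegative real (orthogonality, `DFI_amplifier_orthogonality`);
* **`BC_amplified_moment_le_diag_add_off`** — for `0 < P ≤ #{ℓ ∈ 𝓛 : (ℓ,m)=1}` (`m ∈ S`,
  `1 ≤ m ≤ 2M`): `∑_{m∈S} |∑_{n∈T,(n,m)=1} c_m(n)|² ≤ (2M/P²)(‖∑_m Diag_m(c)‖ + ‖∑_m Off_m(c)‖)`;
* `BC_terms51A_floor_le` — the (5.1)-terms at `⌊L⌋` versus `L` (factor `2`);
  `BC_AMN_le_terms51A` — `AMN' ≤` the (5.1)-terms when `L ≥ M` (the trivial range).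

No new named facts (D-0026).

## References

* S. Bettin, V. Chandee, Adv. Math. 328 (2018) 1234–1262 (arXiv:1502.00769), §2 ((2.2)–(2.4)),
  §5 (5.1). [BettinChandee2018]
* W. Duke, J. Friedlander, H. Iwaniec, Invent. Math. 128 (1997) 23–43, §3 (the amplifier).
  [DukeFriedlanderIwaniec1997]
-/

noncomputable section

open Finset

namespace Literature.NumberTheory.LFunctions


/-- **Orthogonality for `m`-dependent coefficients**: with
`Σ_m(c) = ∑_{ℓ₁,n₁,ℓ₂,n₂ : (ℓ₂n₂,m)=1, ℓ₁n₁≡ℓ₂n₂ (m)} c_m(n₁) conj c_m(n₂)`,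
`φ(m) Σ_m(c) = ∑_χ |∑_{ℓ∈𝓛} χ(ℓ)|² |∑_{n∈T} c_m(n) χ(n)|²`; hence `Σ_m(c)` is a nonnegative real
(the tree's `DFI_amplifier_orthogonality` with `u = 1`). [cite: BettinChandee2018, §2] -/
theorem BC_ampSigma_re_nonneg (c : ℕ → ℕ → ℂ) (T 𝓛 : Finset ℕ) {m : ℕ} (hm : 0 < m) :
    (∑ ℓ₁ ∈ 𝓛, ∑ n₁ ∈ T, ∑ ℓ₂ ∈ 𝓛, ∑ n₂ ∈ T,
        if (ℓ₂ * n₂).Coprime m ∧ ((ℓ₁ * n₁ : ℕ) : ZMod m) = ((ℓ₂ * n₂ : ℕ) : ZMod m) then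
          c m n₁ * (starRingEnd ℂ) (c m n₂) else 0) =
      (((∑ ℓ₁ ∈ 𝓛, ∑ n₁ ∈ T, ∑ ℓ₂ ∈ 𝓛, ∑ n₂ ∈ T,
        if (ℓ₂ * n₂).Coprime m ∧ ((ℓ₁ * n₁ : ℕ) : ZMod m) = ((ℓ₂ * n₂ : ℕ) : ZMod m) then
          c m n₁ * (starRingEnd ℂ) (c m n₂) else 0).re : ℝ) : ℂ) ∧
    0 ≤ (∑ ℓ₁ ∈ 𝓛, ∑ n₁ ∈ T, ∑ ℓ₂ ∈ 𝓛, ∑ n₂ ∈ T,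
        if (ℓ₂ * n₂).Coprime m ∧ ((ℓ₁ * n₁ : ℕ) : ZMod m) = ((ℓ₂ * n₂ : ℕ) : ZMod m) then
          c m n₁ * (starRingEnd ℂ) (c m n₂) else 0).re := by
  haveI : NeZero m := ⟨hm.ne'⟩
  have h := DFI_amplifier_orthogonality m 𝓛 T (fun _ => (1 : ℂ)) (c m)
  simp only [one_mul] at h
  have hφ : (0 : ℝ) < m.totient := by exact_mod_cast Nat.totient_pos.mpr hm
  set Sg : ℂ := ∑ ℓ₁ ∈ 𝓛, ∑ n₁ ∈ T, ∑ ℓ₂ ∈ 𝓛, ∑ n₂ ∈ T,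
    if (ℓ₂ * n₂).Coprime m ∧ ((ℓ₁ * n₁ : ℕ) : ZMod m) = ((ℓ₂ * n₂ : ℕ) : ZMod m) then
      c m n₁ * (starRingEnd ℂ) (c m n₂) else 0 with hSg
  set R : ℝ := ∑ χ : DirichletCharacter ℂ m, ‖∑ ℓ ∈ 𝓛, χ (ℓ : ZMod m)‖ ^ 2 *
    ‖∑ n ∈ T, c m n * χ (n : ZMod m)‖ ^ 2 with hR
  have hR0 : 0 ≤ R := Finset.sum_nonneg fun _ _ => by positivity
  have hφC : (m.totient : ℂ) ≠ 0 := by exact_mod_cast hφ.ne'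
  have hS : Sg = ((R / m.totient : ℝ) : ℂ) := by
    have hR' : (R : ℂ) = (m.totient : ℂ) * Sg := by
      rw [hR, Complex.ofReal_sum]
      exact h
    push_cast
    rw [hR', mul_comm, mul_div_assoc, div_self hφC, mul_one]
  constructor
  · rw [hS, Complex.ofReal_re]
  · rw [hS, Complex.ofReal_re]; positivity

/-- **The amplified second moment for `m`-dependent coefficients over a set `S` of `m`**
(Bettin–Chandee §2: "`𝓒_b ≪ M L^{-2+ε} 𝓓_b`" and "`𝓓_b = 𝒟_b + 𝒪_b`, where `𝒟_b` is the
contribution … from the diagonal terms `ℓ₁n₁ = ℓ₂n₂`, and `𝒪_b` is the sum restricted to the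
off-diagonal terms"; the tree's `kfCS_le_diag_add_off` is the case `c_m(n) = γ_n e(k m̄/(bn))`):
for any coefficients `c_m(n)`, any finite `T`, amplifier set `𝓛` and set `S` of `1 ≤ m ≤ 2M`, if
`0 < P ≤ #{ℓ ∈ 𝓛 : (ℓ,m) = 1}` for every `m ∈ S`, then
`∑_{m∈S} |∑_{n∈T,(n,m)=1} c_m(n)|² ≤ (2M/P²) (‖∑_{m∈S} Diag_m(c)‖ + ‖∑_{m∈S} Off_m(c)‖)`, where
`Diag_m`, `Off_m` are the parts `ℓ₁n₁ = ℓ₂n₂`, `ℓ₁n₁ ≠ ℓ₂n₂` of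
`Σ_m(c) = ∑_{ℓ₁,n₁,ℓ₂,n₂ : (ℓ₂n₂,m)=1, ℓ₁n₁≡ℓ₂n₂ (m)} c_m(n₁) conj c_m(n₂)`.
[cite: BettinChandee2018, §2 ((2.2)–(2.4))] -/
theorem BC_amplified_moment_le_diag_add_off (c : ℕ → ℕ → ℂ) (T 𝓛 S : Finset ℕ) (M : ℝ)
    (hS : ∀ m ∈ S, 0 < m ∧ (m : ℝ) ≤ 2 * M) {P : ℝ} (hP : 0 < P)
    (hP𝓛 : ∀ m ∈ S, P ≤ ((𝓛.filter (fun ℓ => ℓ.Coprime m)).card : ℝ)) :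
    ∑ m ∈ S, ‖∑ n ∈ T with n.Coprime m, c m n‖ ^ 2 ≤ 2 * M / P ^ 2 *
      (‖∑ m ∈ S, ∑ ℓ₁ ∈ 𝓛, ∑ n₁ ∈ T, ∑ ℓ₂ ∈ 𝓛, ∑ n₂ ∈ T,
          (if ℓ₁ * n₁ = ℓ₂ * n₂ then
            (if (ℓ₂ * n₂).Coprime m ∧ ((ℓ₁ * n₁ : ℕ) : ZMod m) = ((ℓ₂ * n₂ : ℕ) : ZMod m) then
              c m n₁ * (starRingEnd ℂ) (c m n₂) else 0) else 0)‖ +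
        ‖∑ m ∈ S, ∑ ℓ₁ ∈ 𝓛, ∑ n₁ ∈ T, ∑ ℓ₂ ∈ 𝓛, ∑ n₂ ∈ T,
          (if ℓ₁ * n₁ = ℓ₂ * n₂ then 0 else
            (if (ℓ₂ * n₂).Coprime m ∧ ((ℓ₁ * n₁ : ℕ) : ZMod m) = ((ℓ₂ * n₂ : ℕ) : ZMod m) then
              c m n₁ * (starRingEnd ℂ) (c m n₂) else 0))‖) := by
  -- termwise: `|X_m|² ≤ (2M/P²) (Σ_m).re`
  have hterm : ∀ m ∈ S, ‖∑ n ∈ T with n.Coprime m, c m n‖ ^ 2 ≤ 2 * M / P ^ 2 *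
      (∑ ℓ₁ ∈ 𝓛, ∑ n₁ ∈ T, ∑ ℓ₂ ∈ 𝓛, ∑ n₂ ∈ T,
        if (ℓ₂ * n₂).Coprime m ∧ ((ℓ₁ * n₁ : ℕ) : ZMod m) = ((ℓ₂ * n₂ : ℕ) : ZMod m) then
          c m n₁ * (starRingEnd ℂ) (c m n₂) else 0).re := by
    intro m hm
    obtain ⟨hm0, hm2⟩ := hS m hm
    haveI : NeZero m := ⟨hm0.ne'⟩
    have h1 := DFI_amplifier_bound_of_le_card m 𝓛 T (c m) hP (hP𝓛 m hm)
    have hre := BC_ampSigma_re_nonneg c T 𝓛 hm0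
    have hnorm : ‖∑ ℓ₁ ∈ 𝓛, ∑ n₁ ∈ T, ∑ ℓ₂ ∈ 𝓛, ∑ n₂ ∈ T,
        (if (ℓ₂ * n₂).Coprime m ∧ ((ℓ₁ * n₁ : ℕ) : ZMod m) = ((ℓ₂ * n₂ : ℕ) : ZMod m) then
          c m n₁ * (starRingEnd ℂ) (c m n₂) else 0)‖ =
        (∑ ℓ₁ ∈ 𝓛, ∑ n₁ ∈ T, ∑ ℓ₂ ∈ 𝓛, ∑ n₂ ∈ T,
          if (ℓ₂ * n₂).Coprime m ∧ ((ℓ₁ * n₁ : ℕ) : ZMod m) = ((ℓ₂ * n₂ : ℕ) : ZMod m) then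
            c m n₁ * (starRingEnd ℂ) (c m n₂) else 0).re := by
      rw [hre.1, Complex.norm_real, Real.norm_of_nonneg hre.2, Complex.ofReal_re]
    rw [hnorm] at h1
    have hφ : (m.totient : ℝ) ≤ 2 * M := le_trans (by exact_mod_cast Nat.totient_le m) hm2
    have hre2 := hre.2
    calc _ ≤ _ := h1
      _ ≤ _ := by gcongr
  rcases S.eq_empty_or_nonempty with rfl | ⟨m₀, hm₀⟩
  · simp
  have hM : 0 ≤ 2 * M / P ^ 2 := by
    have h2 := (hS m₀ hm₀).2
    have h1 : (0 : ℝ) < m₀ := by exact_mod_cast (hS m₀ hm₀).1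
    have : 0 ≤ M := by linarith
    positivity
  refine (Finset.sum_le_sum hterm).trans ?_
  rw [← Finset.mul_sum]
  refine mul_le_mul_of_nonneg_left ?_ hM
  rw [← Complex.re_sum]
  -- `Σ_m = Diag_m + Off_m`
  have hsplit : ∀ m : ℕ, (∑ ℓ₁ ∈ 𝓛, ∑ n₁ ∈ T, ∑ ℓ₂ ∈ 𝓛, ∑ n₂ ∈ T,
      (if (ℓ₂ * n₂).Coprime m ∧ ((ℓ₁ * n₁ : ℕ) : ZMod m) = ((ℓ₂ * n₂ : ℕ) : ZMod m) then
        c m n₁ * (starRingEnd ℂ) (c m n₂) else 0)) =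
      (∑ ℓ₁ ∈ 𝓛, ∑ n₁ ∈ T, ∑ ℓ₂ ∈ 𝓛, ∑ n₂ ∈ T,
        (if ℓ₁ * n₁ = ℓ₂ * n₂ then
          (if (ℓ₂ * n₂).Coprime m ∧ ((ℓ₁ * n₁ : ℕ) : ZMod m) = ((ℓ₂ * n₂ : ℕ) : ZMod m) then
            c m n₁ * (starRingEnd ℂ) (c m n₂) else 0) else 0)) +
      (∑ ℓ₁ ∈ 𝓛, ∑ n₁ ∈ T, ∑ ℓ₂ ∈ 𝓛, ∑ n₂ ∈ T,
        (if ℓ₁ * n₁ = ℓ₂ * n₂ then 0 else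
          (if (ℓ₂ * n₂).Coprime m ∧ ((ℓ₁ * n₁ : ℕ) : ZMod m) = ((ℓ₂ * n₂ : ℕ) : ZMod m) then
            c m n₁ * (starRingEnd ℂ) (c m n₂) else 0))) := by
    intro m
    rw [← Finset.sum_add_distrib]
    refine Finset.sum_congr rfl fun ℓ₁ _ => ?_
    rw [← Finset.sum_add_distrib]
    refine Finset.sum_congr rfl fun n₁ _ => ?_
    rw [← Finset.sum_add_distrib]
    refine Finset.sum_congr rfl fun ℓ₂ _ => ?_
    rw [← Finset.sum_add_distrib]
    refine Finset.sum_congr rfl fun n₂ _ => ?_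
    split_ifs <;> simp
  simp_rw [hsplit]
  rw [Finset.sum_add_distrib, Complex.add_re]
  exact add_le_add (Complex.re_le_norm _) (Complex.re_le_norm _)


/-! ### The six terms of (5.1), general `A`: `⌊L⌋` versus `L`, and the trivial range `L ≥ M` -/

/-- **The (5.1)-terms at `⌊L⌋` versus `L`** (general `A`): for `L ≥ 1`, `b ≥ 1`, `M, N', A > 0`,
`T₅₁(⌊L⌋) ≤ 2 T₅₁(L)` where
`T₅₁(L) = AM(bN')^{1/2}L^{-1/2} + AM²/(bLN') + M²/L + b^{3/4}AM^{1/2}N'^{5/4}L^{-1/2} + b^{1/2}AL^{3/2}N'^{7/4} + b^{1/2}A^{1/2}MN'/L`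
(`⌊L⌋ ≤ L ≤ 2⌊L⌋`; the tree's `BC_terms51_floor_le` is the case `A = 1`). [folklore] -/
theorem BC_terms51A_floor_le {L : ℝ} (hL : 1 ≤ L) {b : ℕ} (hb : 0 < b) {M N' A : ℝ} (hM : 0 < M)
    (hN : 0 < N') (hA : 0 < A) :
    A * M * ((b : ℝ) * N') ^ (1 / 2 : ℝ) * ((⌊L⌋₊ : ℕ) : ℝ) ^ (-(1 / 2) : ℝ) +
        A * M ^ 2 / ((b : ℝ) * ((⌊L⌋₊ : ℕ) : ℝ) * N') + M ^ 2 / ((⌊L⌋₊ : ℕ) : ℝ) +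
        (b : ℝ) ^ (3 / 4 : ℝ) * A * M ^ (1 / 2 : ℝ) * N' ^ (5 / 4 : ℝ) * ((⌊L⌋₊ : ℕ) : ℝ) ^ (-(1 / 2) : ℝ) +
        (b : ℝ) ^ (1 / 2 : ℝ) * A * ((⌊L⌋₊ : ℕ) : ℝ) ^ (3 / 2 : ℝ) * N' ^ (7 / 4 : ℝ) +
        (b : ℝ) ^ (1 / 2 : ℝ) * A ^ (1 / 2 : ℝ) * M * N' / ((⌊L⌋₊ : ℕ) : ℝ) ≤
    2 * (A * M * ((b : ℝ) * N') ^ (1 / 2 : ℝ) * L ^ (-(1 / 2) : ℝ) + A * M ^ 2 / ((b : ℝ) * L * N') +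
        M ^ 2 / L + (b : ℝ) ^ (3 / 4 : ℝ) * A * M ^ (1 / 2 : ℝ) * N' ^ (5 / 4 : ℝ) * L ^ (-(1 / 2) : ℝ) +
        (b : ℝ) ^ (1 / 2 : ℝ) * A * L ^ (3 / 2 : ℝ) * N' ^ (7 / 4 : ℝ) +
        (b : ℝ) ^ (1 / 2 : ℝ) * A ^ (1 / 2 : ℝ) * M * N' / L) := by
  set L₁ : ℝ := ((⌊L⌋₊ : ℕ) : ℝ) with hL₁
  have hb0 : (0 : ℝ) < b := by exact_mod_cast hb
  have hL0 : 0 < L := by linarith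
  have h1 : L₁ ≤ L := Nat.floor_le hL0.le
  have h2 : L < L₁ + 1 := Nat.lt_floor_add_one L
  have h3 : (1 : ℝ) ≤ L₁ := by
    have : 1 ≤ ⌊L⌋₊ := (Nat.one_le_floor_iff _).mpr hL
    rw [hL₁]; exact_mod_cast this
  have hL₁0 : 0 < L₁ := by linarith
  have h4 : L ≤ 2 * L₁ := by linarith
  have hinv : 1 / L₁ ≤ 2 / L := by
    rw [div_le_div_iff₀ hL₁0 hL0]; linarith
  have hm12 : L₁ ^ (-(1 / 2) : ℝ) ≤ 2 * L ^ (-(1 / 2) : ℝ) := by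
    have ha : L₁ ^ (-(1 / 2) : ℝ) ≤ (L / 2) ^ (-(1 / 2) : ℝ) :=
      Real.rpow_le_rpow_of_nonpos (by positivity) (by linarith) (by norm_num)
    have hb' : (L / 2) ^ (-(1 / 2) : ℝ) = (1 / 2) ^ (-(1 / 2) : ℝ) * L ^ (-(1 / 2) : ℝ) := by
      rw [show L / 2 = (1 / 2) * L by ring, Real.mul_rpow (by norm_num) hL0.le]
    have hc : (1 / 2 : ℝ) ^ (-(1 / 2) : ℝ) ≤ 2 := by
      rw [Real.rpow_neg (by norm_num), ← Real.inv_rpow (by norm_num)]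
      norm_num
      calc (2 : ℝ) ^ (1 / 2 : ℝ) ≤ 2 ^ (1 : ℝ) :=
            Real.rpow_le_rpow_of_exponent_le (by norm_num) (by norm_num)
        _ = 2 := Real.rpow_one 2
    have hL12 : 0 ≤ L ^ (-(1 / 2) : ℝ) := Real.rpow_nonneg hL0.le _
    calc L₁ ^ (-(1 / 2) : ℝ) ≤ (1 / 2) ^ (-(1 / 2) : ℝ) * L ^ (-(1 / 2) : ℝ) := ha.trans (le_of_eq hb')
      _ ≤ 2 * L ^ (-(1 / 2) : ℝ) := mul_le_mul_of_nonneg_right hc hL12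
  have h32 : L₁ ^ (3 / 2 : ℝ) ≤ L ^ (3 / 2 : ℝ) := Real.rpow_le_rpow hL₁0.le h1 (by norm_num)
  -- termwise
  have t1 : A * M * ((b : ℝ) * N') ^ (1 / 2 : ℝ) * L₁ ^ (-(1 / 2) : ℝ) ≤
      2 * (A * M * ((b : ℝ) * N') ^ (1 / 2 : ℝ) * L ^ (-(1 / 2) : ℝ)) := by
    have h0 : 0 ≤ A * M * ((b : ℝ) * N') ^ (1 / 2 : ℝ) := by positivity
    calc A * M * ((b : ℝ) * N') ^ (1 / 2 : ℝ) * L₁ ^ (-(1 / 2) : ℝ)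
        ≤ A * M * ((b : ℝ) * N') ^ (1 / 2 : ℝ) * (2 * L ^ (-(1 / 2) : ℝ)) :=
          mul_le_mul_of_nonneg_left hm12 h0
      _ = 2 * (A * M * ((b : ℝ) * N') ^ (1 / 2 : ℝ) * L ^ (-(1 / 2) : ℝ)) := by ring
  have t2 : A * M ^ 2 / ((b : ℝ) * L₁ * N') ≤ 2 * (A * M ^ 2 / ((b : ℝ) * L * N')) := by
    have e1 : A * M ^ 2 / ((b : ℝ) * L₁ * N') = A * M ^ 2 / ((b : ℝ) * N') * (1 / L₁) := by
      field_simp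
    have e2 : 2 * (A * M ^ 2 / ((b : ℝ) * L * N')) = A * M ^ 2 / ((b : ℝ) * N') * (2 / L) := by
      field_simp
    rw [e1, e2]
    exact mul_le_mul_of_nonneg_left hinv (by positivity)
  have t3 : M ^ 2 / L₁ ≤ 2 * (M ^ 2 / L) := by
    have e1 : M ^ 2 / L₁ = M ^ 2 * (1 / L₁) := by field_simp
    have e2 : 2 * (M ^ 2 / L) = M ^ 2 * (2 / L) := by field_simp
    rw [e1, e2]
    exact mul_le_mul_of_nonneg_left hinv (by positivity)
  have t4 : (b : ℝ) ^ (3 / 4 : ℝ) * A * M ^ (1 / 2 : ℝ) * N' ^ (5 / 4 : ℝ) * L₁ ^ (-(1 / 2) : ℝ) ≤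
      2 * ((b : ℝ) ^ (3 / 4 : ℝ) * A * M ^ (1 / 2 : ℝ) * N' ^ (5 / 4 : ℝ) * L ^ (-(1 / 2) : ℝ)) := by
    have h0 : 0 ≤ (b : ℝ) ^ (3 / 4 : ℝ) * A * M ^ (1 / 2 : ℝ) * N' ^ (5 / 4 : ℝ) := by positivity
    calc (b : ℝ) ^ (3 / 4 : ℝ) * A * M ^ (1 / 2 : ℝ) * N' ^ (5 / 4 : ℝ) * L₁ ^ (-(1 / 2) : ℝ)
        ≤ (b : ℝ) ^ (3 / 4 : ℝ) * A * M ^ (1 / 2 : ℝ) * N' ^ (5 / 4 : ℝ) * (2 * L ^ (-(1 / 2) : ℝ)) :=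
          mul_le_mul_of_nonneg_left hm12 h0
      _ = 2 * ((b : ℝ) ^ (3 / 4 : ℝ) * A * M ^ (1 / 2 : ℝ) * N' ^ (5 / 4 : ℝ) * L ^ (-(1 / 2) : ℝ)) := by
          ring
  have t5 : (b : ℝ) ^ (1 / 2 : ℝ) * A * L₁ ^ (3 / 2 : ℝ) * N' ^ (7 / 4 : ℝ) ≤
      2 * ((b : ℝ) ^ (1 / 2 : ℝ) * A * L ^ (3 / 2 : ℝ) * N' ^ (7 / 4 : ℝ)) := by
    have h0 : 0 ≤ (b : ℝ) ^ (1 / 2 : ℝ) * A := by positivity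
    have h0' : 0 ≤ N' ^ (7 / 4 : ℝ) := by positivity
    have a : (b : ℝ) ^ (1 / 2 : ℝ) * A * L₁ ^ (3 / 2 : ℝ) * N' ^ (7 / 4 : ℝ) ≤
        (b : ℝ) ^ (1 / 2 : ℝ) * A * L ^ (3 / 2 : ℝ) * N' ^ (7 / 4 : ℝ) :=
      mul_le_mul_of_nonneg_right (mul_le_mul_of_nonneg_left h32 h0) h0'
    have hnn : 0 ≤ (b : ℝ) ^ (1 / 2 : ℝ) * A * L ^ (3 / 2 : ℝ) * N' ^ (7 / 4 : ℝ) := by positivity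
    linarith
  have t6 : (b : ℝ) ^ (1 / 2 : ℝ) * A ^ (1 / 2 : ℝ) * M * N' / L₁ ≤
      2 * ((b : ℝ) ^ (1 / 2 : ℝ) * A ^ (1 / 2 : ℝ) * M * N' / L) := by
    have e1 : (b : ℝ) ^ (1 / 2 : ℝ) * A ^ (1 / 2 : ℝ) * M * N' / L₁ =
        (b : ℝ) ^ (1 / 2 : ℝ) * A ^ (1 / 2 : ℝ) * M * N' * (1 / L₁) := by field_simp
    have e2 : 2 * ((b : ℝ) ^ (1 / 2 : ℝ) * A ^ (1 / 2 : ℝ) * M * N' / L) =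
        (b : ℝ) ^ (1 / 2 : ℝ) * A ^ (1 / 2 : ℝ) * M * N' * (2 / L) := by field_simp
    rw [e1, e2]
    exact mul_le_mul_of_nonneg_left hinv (by positivity)
  linarith [t1, t2, t3, t4, t5, t6]

/-- For `L ≥ max(1, M)`, `N', A ≥ 1/2`, `b ≥ 1`: `AMN' ≤ 4 b^{1/2} A L^{3/2} N'^{7/4} ≤ 4 ×` the
six terms of (5.1) (so that (5.1) is trivial in the range `L > M`; the tree's `BC_MN_le_terms51`
is the case `A = 1`, `N' ≥ 1`). [folklore] -/
theorem BC_AMN_le_terms51A {b : ℕ} (hb : 0 < b) {M N' A L : ℝ} (hM : 0 < M) (hN : 1 / 2 ≤ N')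
    (hA : 0 < A) (hL1 : 1 ≤ L) (hML : M ≤ L) :
    A * M * N' ≤ 4 * (A * M * ((b : ℝ) * N') ^ (1 / 2 : ℝ) * L ^ (-(1 / 2) : ℝ) +
        A * M ^ 2 / ((b : ℝ) * L * N') + M ^ 2 / L +
        (b : ℝ) ^ (3 / 4 : ℝ) * A * M ^ (1 / 2 : ℝ) * N' ^ (5 / 4 : ℝ) * L ^ (-(1 / 2) : ℝ) +
        (b : ℝ) ^ (1 / 2 : ℝ) * A * L ^ (3 / 2 : ℝ) * N' ^ (7 / 4 : ℝ) +
        (b : ℝ) ^ (1 / 2 : ℝ) * A ^ (1 / 2 : ℝ) * M * N' / L) := by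
  have hbr : (1 : ℝ) ≤ b := by exact_mod_cast hb
  have hN0 : 0 < N' := by linarith
  have hL0 : 0 < L := by linarith
  have e1 : (1 : ℝ) ≤ (b : ℝ) ^ (1 / 2 : ℝ) := Real.one_le_rpow hbr (by norm_num)
  have e2 : M ≤ L ^ (3 / 2 : ℝ) := by
    calc M ≤ L := hML
      _ = L ^ (1 : ℝ) := (Real.rpow_one L).symm
      _ ≤ L ^ (3 / 2 : ℝ) := Real.rpow_le_rpow_of_exponent_le hL1 (by norm_num)
  -- `N' ≤ 4 N'^{7/4}` for `N' ≥ 1/2` (`N'^{3/4} ≥ (1/2)^{3/4} ≥ 1/4`)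
  have e3 : N' ≤ 4 * N' ^ (7 / 4 : ℝ) := by
    have h1 : (1 / 4 : ℝ) ≤ N' ^ (3 / 4 : ℝ) := by
      have h2 : (1 / 2 : ℝ) ^ (3 / 4 : ℝ) ≤ N' ^ (3 / 4 : ℝ) :=
        Real.rpow_le_rpow (by norm_num) hN (by norm_num)
      have h3 : (1 / 4 : ℝ) ≤ (1 / 2 : ℝ) ^ (3 / 4 : ℝ) := by
        calc (1 / 4 : ℝ) ≤ (1 / 2 : ℝ) ^ (1 : ℝ) := by rw [Real.rpow_one]; norm_num
          _ ≤ (1 / 2 : ℝ) ^ (3 / 4 : ℝ) :=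
            Real.rpow_le_rpow_of_exponent_ge (by norm_num) (by norm_num) (by norm_num)
      linarith
    have h4 : N' ^ (7 / 4 : ℝ) = N' * N' ^ (3 / 4 : ℝ) := by
      rw [show (7 / 4 : ℝ) = 1 + 3 / 4 by norm_num, Real.rpow_add hN0, Real.rpow_one]
    rw [h4]; nlinarith
  have e4 : A * M * N' ≤ 4 * ((b : ℝ) ^ (1 / 2 : ℝ) * A * L ^ (3 / 2 : ℝ) * N' ^ (7 / 4 : ℝ)) := by
    have hAM : 0 ≤ A * M := by positivity
    calc A * M * N' ≤ A * M * (4 * N' ^ (7 / 4 : ℝ)) := mul_le_mul_of_nonneg_left e3 hAM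
      _ = 4 * (1 * A * M * N' ^ (7 / 4 : ℝ)) := by ring
      _ ≤ 4 * ((b : ℝ) ^ (1 / 2 : ℝ) * A * L ^ (3 / 2 : ℝ) * N' ^ (7 / 4 : ℝ)) := by
          gcongr
  have a1 : 0 ≤ A * M * ((b : ℝ) * N') ^ (1 / 2 : ℝ) * L ^ (-(1 / 2) : ℝ) := by positivity
  have a2 : 0 ≤ A * M ^ 2 / ((b : ℝ) * L * N') := by positivity
  have a3 : 0 ≤ M ^ 2 / L := by positivity
  have a4 : 0 ≤ (b : ℝ) ^ (3 / 4 : ℝ) * A * M ^ (1 / 2 : ℝ) * N' ^ (5 / 4 : ℝ) * L ^ (-(1 / 2) : ℝ) := by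
    positivity
  have a6 : 0 ≤ (b : ℝ) ^ (1 / 2 : ℝ) * A ^ (1 / 2 : ℝ) * M * N' / L := by positivity
  linarith

end Literature.NumberTheory.LFunctions

end
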